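import Literature.NumberTheory.Automorphic.Liu2021.AppendixC.BettiPinningTransport
import Literature.NumberTheory.Automorphic.Liu2021.AppendixC.H1ComparisonFamilyHolds
import Literature.NumberTheory.Automorphic.Liu2021.AppendixC.RestOneLevelInvariants
import Mathlib.Algebra.Colimit.Module
import Mathlib.RingTheory.Flat.Basic
import HarnessLib

/-!
# [Liu 2021, §4.2 l. 2077–2081] the Betti tower `H¹_{B,τ'}(A_∞, ℂ) := colim_K H¹_{B,τ'}(A_K, ℂ)` CONSTRUCTED, with the Hecke action
# induced by the translates and its Betti pinning (the Betti twin of `EtaleH1Tower` §2 + `EtaleHeckeDatumOfTranslates` §§1–2, 4)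

Topic `NumberTheory/Automorphic/Liu2021/AppendixC`; namespace `Literature.NumberTheory.Automorphic.Liu2021.AppendixC`, dot-notation on
`C : Sec42Data P5 isotropicAt` and on its translates `T : C.HeckeTranslates`.  DEFINITIONS WITH BODIES and theorems: NO named fact,
NO instance, NO `sorry` (net Literature debt 0).  Cell `hodgecm-mathlib`, FLOOR-0 programme P5 (sub-line S1∕S1b: the realisation letter
S1-R and the junctions J0∕J1 need ONE Betti pinning of the record curve's Albanese tower to EXIST; census A-p14 (g14)
`S1R-byname-census` §3 M0).  HC_CM is proved only modulo the 7 printed citations until rung 0 closes; nothing printed is asserted here.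

PRINT ([Liu2021] §4.2, FJcycle.tex l. 2077–2081, print p. 49): «Put `H¹_{B,τ'}(A_∞, ℂ) := lim_K H¹_{B,τ'}(A_K, ℂ)`, which is an
admissible representation of `𝔾(𝔸_F^∞)`» — with «By functoriality, we obtain a projective system `{A_K}_K`» (l. 2070) and «the Hecke
correspondences provide a homomorphism `𝔾(𝔸_F^∞) → Aut_E(A_∞)`» (l. 2074).  The tree so far POSITED this module through the hypothesis
structure `Sec42Data.BettiPinning T τ' H rhoB` (`EtaleBettiComparison.lean` :185; the surface line pins the HodgeCM `Tower`,
`pinBettiPinning_of_lemma24`); this file CONSTRUCTS it for every §4.2 datum, exactly as `EtaleH1Tower`∕`EtaleHeckeDatumOfTranslates`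
construct the étale tower and its Hecke action, with `bettiPullAlong τ' f = (f ×_{τ'} ℂ)(ℂ)^*` in place of `ᵗV_ℓ(f)`:
* §1 `Sec42Data.bettiSys`, `Sec42Data.bettiH1Tower C τ'` (`Module.DirectLimit` over the reversed level index `RestOne.Idx C`),
  `Sec42Data.toBettiTower C τ' K` (+ `toBettiTower_pull`, `directedSystem_bettiSys`, `exists_eq_toBettiTower`, `toBettiTower_injective`);
* §2 `HeckeTranslates.bettiHeckeRep T τ' : Representation ℂ C.G (C.bettiH1Tower τ')` from the translates (level components
  `[·]_{gKg⁻¹ ∩ K₀} ∘ Alb(T_g)^*`, glued by `Module.DirectLimit.lift`), its defining formula `bettiHeckeRep_toBettiTower` and the level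
  law `bettiHeckeRep_toBettiTower_of_mem`;
* §3 **`HeckeTranslates.bettiPinningOfTranslates T τ' hIB : C.BettiPinning T τ' (C.bettiH1Tower τ') (T.bettiHeckeRep τ')`** granted injective
  Betti pull-backs `hIB` along the transitions `Alb_u` — and the discharge of `hIB` from the ÉTALE injectivity through any degree-one
  comparison family (`injective_bettiPullAlong_of_injective_dualMap`; the tree's `h1ComparisonFamilyAlong` is one, [SGA4 XI 4.4]).

## References
* [Liu2021] Y. Liu, *Fourier–Jacobi cycles and arithmetic relative trace formula*, Camb. J. Math. 9 (2021): §4.2 l. 2066–2081, Thm. 4.18 (1) l. 2239.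
* [Milne2005ShimuraVarieties] J. S. Milne, *Introduction to Shimura varieties* (2005), §5 p. 57–58 (Hecke operators `T(g)`, the level acts trivially).
* [Hatcher2002] A. Hatcher, *Algebraic Topology*, §3.1 (contravariance of singular cohomology).
-/

noncomputable section

open CategoryTheory NumberField

namespace Literature.NumberTheory.Automorphic.Liu2021.AppendixC

open Literature.AlgebraicGeometry.Motives (AbelianVariety)
open Literature.AlgebraicGeometry.Motives.AbelianVariety (rationalTateModuleMap)

/-! ## §0 Injective Betti pull-backs from injective étale pull-backs (bookkeeping over any degree-one comparison family) -/

/-- **Injective Betti pull-backs from injective étale pull-backs**, through any degree-one comparison family `c` along `(τ', ι)` (e.g. the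
tree's `h1ComparisonFamilyAlong τ' ℓ ι`): `c_{A} ∘ f^* = ((V_ℓ f)^∨ ⊗ 1) ∘ c_B` with `c` bijective and `ℚ̄_ℓ ∕ ℚ_ℓ` flat.
[cite: SGA4Tome3, Exp. XI Thm. 4.4] [cite: Liu2021, §4.2 (FJcycle.tex l. 2154)] -/
theorem injective_bettiPullAlong_of_injective_dualMap {E : Type} [Field E] (τ' : E →+* ℂ) {ℓ : ℕ} [Fact ℓ.Prime]
    {ι : ℂ ≃+* AlgebraicClosure ℚ_[ℓ]} (c : H1ComparisonFamily (E := E) τ' ℓ ι) {A B : AbelianVariety E} (f : A ⟶ B)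
    (h : Function.Injective (rationalTateModuleMap ℓ f).dualMap) : Function.Injective (bettiPullAlong τ' f) := by
  intro y y' hyy'
  have hbc : Function.Injective (((rationalTateModuleMap ℓ f).dualMap).baseChange (AlgebraicClosure ℚ_[ℓ])) := by
    have hflat := Module.Flat.lTensor_preserves_injective_linearMap (M := AlgebraicClosure ℚ_[ℓ]) (rationalTateModuleMap ℓ f).dualMap h
    intro a b hab
    exact hflat hab
  have key : ((rationalTateModuleMap ℓ f).dualMap).baseChange (AlgebraicClosure ℚ_[ℓ]) (c.cmp B y) =
      ((rationalTateModuleMap ℓ f).dualMap).baseChange (AlgebraicClosure ℚ_[ℓ]) (c.cmp B y') := by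
    rw [← c.natural, ← c.natural, hyy']
  exact (c.bijective B).1 (hbc key)


variable {F E : Type} [Field F] [NumberField F] [IsTotallyReal F] [Field E] [NumberField E] [Algebra F E]
  [IsTotallyComplex E] [Algebra.IsQuadraticExtension F E]
variable {P5 : PropC5Data F E} {isotropicAt : ℕ → Prop}

/-! ## §1 The Betti direct system over the sufficiently small levels and its colimit `H¹_{B,τ'}(A_∞, ℂ)` -/

namespace Sec42Data

variable (C : Sec42Data P5 isotropicAt) (τ' : E →+* ℂ)

open RestOne (Idx)
open scoped Classical

/-- The objects `K ↦ H¹_{B,τ'}(A_K, ℂ)` of the Betti direct system, on the reversed level index `RestOne.Idx C = (C5.SmallLevel K₀)ᵒᵈ`.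
[cite: Liu2021, §4.2 (FJcycle.tex l. 2079)] -/
abbrev bettiSysObj (i : Idx C) : Type :=
  C.bettiH1 τ' (OrderDual.ofDual i)

/-- The transition maps: for `K' ⊆ K` the pull-back `Alb_{u^{K'}_K}^* : H¹_{B,τ'}(A_K, ℂ) → H¹_{B,τ'}(A_{K'}, ℂ)` («By functoriality, we
obtain a projective system `{A_K}_K`», l. 2070). [cite: Liu2021, §4.2 (FJcycle.tex l. 2066–2072, 2079)] -/
def bettiSys (i j : Idx C) (h : i ≤ j) : C.bettiSysObj τ' i →ₗ[ℂ] C.bettiSysObj τ' j :=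
  bettiPullAlong τ' (C.Atr (homOfLE (show OrderDual.ofDual j ≤ OrderDual.ofDual i from h)))

/-- Unfolding of a transition map. [cite: Liu2021, §4.2 (FJcycle.tex l. 2079)] -/
theorem bettiSys_apply (i j : Idx C) (h : i ≤ j) (y : C.bettiSysObj τ' i) :
    C.bettiSys τ' i j h y = bettiPullAlong τ' (C.Atr (homOfLE (show OrderDual.ofDual j ≤ OrderDual.ofDual i from h))) y :=
  rfl

/-- The Betti direct system is a directed system (`Atr_id`∕`Atr_comp` and the functoriality of `H¹_B`).
[cite: Liu2021, §4.2 (FJcycle.tex l. 2070–2072)] -/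
theorem directedSystem_bettiSys : DirectedSystem (C.bettiSysObj τ') (C.bettiSys τ' · · ·) where
  map_self i y := by
    show bettiPullAlong τ' (C.Atr (homOfLE _)) y = y
    have hid : (homOfLE (le_refl (OrderDual.ofDual i)) : OrderDual.ofDual i ⟶ OrderDual.ofDual i) = 𝟙 _ := rfl
    rw [hid, C.Atr_id, bettiPullAlong_id_apply]
  map_map {i j k} hij hjk y := by
    show bettiPullAlong τ' (C.Atr (homOfLE _)) (bettiPullAlong τ' (C.Atr (homOfLE _)) y) = bettiPullAlong τ' (C.Atr (homOfLE _)) y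
    rw [← bettiPullAlong_comp_apply, ← C.Atr_comp]
    rfl

/-- **`H¹_{B,τ'}(A_∞, ℂ) := colim_K H¹_{B,τ'}(A_K, ℂ)`** over the sufficiently small levels (l. 2079), as a `Module.DirectLimit`.
[cite: Liu2021, §4.2 (FJcycle.tex l. 2077–2081)] -/
abbrev bettiH1Tower : Type :=
  Module.DirectLimit (C.bettiSysObj τ') (C.bettiSys τ')

/-- The canonical map `[·]_K : H¹_{B,τ'}(A_K, ℂ) → H¹_{B,τ'}(A_∞, ℂ)` into the colimit. [cite: Liu2021, §4.2 (FJcycle.tex l. 2079)] -/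
def toBettiTower (K : C5.SmallLevel C.S.K₀) : C.bettiH1 τ' K →ₗ[ℂ] C.bettiH1Tower τ' :=
  Module.DirectLimit.of ℂ (Idx C) (C.bettiSysObj τ') (C.bettiSys τ') (OrderDual.toDual K)

/-- Compatibility of the canonical maps with pull-back along `Alb_{u^{K'}_K}` for `K' ⊆ K`: `[Alb_u^* y]_{K'} = [y]_K`.
[cite: Liu2021, §4.2 (FJcycle.tex l. 2070, 2079)] -/
theorem toBettiTower_pull {K K' : C5.SmallLevel C.S.K₀} (f : K' ⟶ K) (y : C.bettiH1 τ' K) :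
    C.toBettiTower τ' K' (bettiPullAlong τ' (C.Atr f) y) = C.toBettiTower τ' K y := by
  have hle : K' ≤ K := leOfHom f
  have hf : f = homOfLE hle := Subsingleton.elim _ _
  have key := @Module.DirectLimit.of_f ℂ _ (Idx C) _ (C.bettiSysObj τ') _ _ (C.bettiSys τ') _
    (OrderDual.toDual K) (OrderDual.toDual K') hle y
  have hsys : C.bettiSys τ' (OrderDual.toDual K) (OrderDual.toDual K') hle y = bettiPullAlong τ' (C.Atr f) y := by
    rw [hf]; rfl
  rw [hsys] at key
  exact key

/-- Every class of `H¹_{B,τ'}(A_∞, ℂ)` is a level class `[y]_K` (directed colimit, index inhabited by `K₀`).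
[cite: Liu2021, §4.2 (FJcycle.tex l. 2079)] -/
theorem exists_eq_toBettiTower (x : C.bettiH1Tower τ') :
    ∃ (K : C5.SmallLevel C.S.K₀) (y : C.bettiH1 τ' K), C.toBettiTower τ' K y = x := by
  haveI := RestOne.isDirectedOrder_idx C
  haveI := RestOne.nonempty_idx C
  obtain ⟨i, y, hy⟩ := Module.DirectLimit.exists_of (R := ℂ) (ι := Idx C) (G := C.bettiSysObj τ') (f := C.bettiSys τ') x
  exact ⟨OrderDual.ofDual i, y, hy⟩

/-- **`[·]_K` is injective** at every level, granted that every pull-back `Alb_u^*` along the transitions is injective (a directed colimit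
with injective transition maps). [cite: Liu2021, §4.2 (FJcycle.tex l. 2079) and Thm. 4.18 (1) l. 2239] -/
theorem toBettiTower_injective
    (hIB : ∀ ⦃K K' : C5.SmallLevel C.S.K₀⦄ (f : K' ⟶ K), Function.Injective (bettiPullAlong τ' (C.Atr f)))
    (K : C5.SmallLevel C.S.K₀) : Function.Injective (C.toBettiTower τ' K) := by
  haveI := RestOne.isDirectedOrder_idx C
  haveI := C.directedSystem_bettiSys τ'
  refine (injective_iff_map_eq_zero (C.toBettiTower τ' K)).2 fun y hy => ?_
  obtain ⟨j, hij, hj⟩ := Module.DirectLimit.of.zero_exact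
    (R := ℂ) (ι := Idx C) (G := C.bettiSysObj τ') (f := C.bettiSys τ') (i := OrderDual.toDual K) (x := y) hy
  have hle : OrderDual.ofDual j ≤ K := hij
  have hj' : bettiPullAlong τ' (C.Atr (homOfLE hle)) y = 0 := hj
  exact hIB (homOfLE hle) (a₁ := y) (a₂ := 0) (by rw [hj', map_zero])

end Sec42Data

/-! ## §2 The Hecke action on `H¹_{B,τ'}(A_∞, ℂ)` induced by the translates -/

namespace Sec42Data.HeckeTranslates

variable {C : Sec42Data P5 isotropicAt} (T : C.HeckeTranslates) (τ' : E →+* ℂ)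

open RestOne (Idx)
open scoped Classical

/-- Level-`K` component of the action of `g`: `y ↦ [Alb(T_g)^* y]_{gKg⁻¹ ∩ K₀}` for `T_g : X_{gKg⁻¹ ∩ K₀} → X_K` («the Hecke correspondences
provide a homomorphism `𝔾(𝔸_F^∞) → Aut_E(A_∞)`», l. 2074). [cite: Liu2021, §4.2 (FJcycle.tex l. 2074, 2079–2081)] -/
def bettiHeckeAux (g : C.G) (K : C5.SmallLevel C.S.K₀) : C.bettiH1 τ' K →ₗ[ℂ] C.bettiH1Tower τ' :=
  C.toBettiTower τ' (C5.heckeLevel g K) ∘ₗ bettiPullAlong τ' (T.albTr g (C5.heckeLevel g K) K (C5.heckeLE_heckeLevel g K))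

/-- Unfolding of `bettiHeckeAux`. [cite: Liu2021, §4.2 (FJcycle.tex l. 2074)] -/
theorem bettiHeckeAux_apply (g : C.G) (K : C5.SmallLevel C.S.K₀) (y : C.bettiH1 τ' K) :
    T.bettiHeckeAux τ' g K y =
      C.toBettiTower τ' (C5.heckeLevel g K) (bettiPullAlong τ' (T.albTr g (C5.heckeLevel g K) K (C5.heckeLE_heckeLevel g K)) y) :=
  rfl

/-- **Independence of the source level**: for ANY admissible `L` (`g⁻¹Lg ⊆ K`), `[Alb(T_g : X_L → X_K)^* y]_L` is the same class.
[cite: Liu2021, §4.2 (FJcycle.tex l. 2070–2074)] -/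
theorem toBettiTower_bettiPullAlong_albTr (g : C.G) {L K : C5.SmallLevel C.S.K₀} (h : C5.HeckeLE g L K) (y : C.bettiH1 τ' K) :
    C.toBettiTower τ' L (bettiPullAlong τ' (T.albTr g L K h) y) = T.bettiHeckeAux τ' g K y := by
  have hle : L ≤ C5.heckeLevel g K := C5.le_heckeLevel_of_heckeLE h
  have e : T.albTr g L K h = C.Atr (homOfLE hle) ≫ T.albTr g (C5.heckeLevel g K) K (C5.heckeLE_heckeLevel g K) :=
    (T.Atr_comp_albTr (homOfLE hle) _).symm
  rw [bettiHeckeAux_apply, e, bettiPullAlong_comp_apply, C.toBettiTower_pull τ' (homOfLE hle)]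

/-- The level components are compatible with the transition maps (so they descend to the colimit).
[cite: Liu2021, §4.2 (FJcycle.tex l. 2070–2074)] -/
theorem bettiHeckeAux_sys (g : C.G) (i j : Idx C) (hij : i ≤ j) (y : C.bettiSysObj τ' i) :
    T.bettiHeckeAux τ' g (OrderDual.ofDual j) (C.bettiSys τ' i j hij y) = T.bettiHeckeAux τ' g (OrderDual.ofDual i) y := by
  have hle : OrderDual.ofDual j ≤ OrderDual.ofDual i := hij
  show C.toBettiTower τ' (C5.heckeLevel g (OrderDual.ofDual j))
      (bettiPullAlong τ' (T.albTr g (C5.heckeLevel g (OrderDual.ofDual j)) (OrderDual.ofDual j)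
        (C5.heckeLE_heckeLevel g (OrderDual.ofDual j)))
        (bettiPullAlong τ' (C.Atr (homOfLE hle)) y)) = _
  rw [← bettiPullAlong_comp_apply, T.albTr_comp_Atr]
  exact T.toBettiTower_bettiPullAlong_albTr τ' g _ y

/-- **The action of `g ∈ 𝔾(𝔸_F^∞)` on `H¹_{B,τ'}(A_∞, ℂ)`**, `ℂ`-linear, glued from the level components by `Module.DirectLimit.lift`.
[cite: Liu2021, §4.2 (FJcycle.tex l. 2074, 2079–2081)] -/
def bettiHecke (g : C.G) : C.bettiH1Tower τ' →ₗ[ℂ] C.bettiH1Tower τ' :=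
  Module.DirectLimit.lift ℂ (Idx C) (C.bettiSysObj τ') (C.bettiSys τ') (fun i => T.bettiHeckeAux τ' g (OrderDual.ofDual i))
    fun i j hij y => T.bettiHeckeAux_sys τ' g i j hij y

/-- On a level class the action is the level component. [cite: Liu2021, §4.2 (FJcycle.tex l. 2074)] -/
theorem bettiHecke_of (g : C.G) (K : C5.SmallLevel C.S.K₀) (y : C.bettiH1 τ' K) :
    T.bettiHecke τ' g (Module.DirectLimit.of ℂ (Idx C) (C.bettiSysObj τ') (C.bettiSys τ') (OrderDual.toDual K) y) =
      T.bettiHeckeAux τ' g K y :=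
  Module.DirectLimit.lift_of _ _ _

/-- **Defining formula**: `g · [y]_K = [Alb(T_g : X_L → X_K)^* y]_L` for every admissible source level `L` (`g⁻¹Lg ⊆ K`) — the `b_hecke` law
of `BettiPinning`. [cite: Liu2021, §4.2 (FJcycle.tex l. 2074, 2079–2081)] -/
theorem bettiHecke_toBettiTower (g : C.G) {L K : C5.SmallLevel C.S.K₀} (h : C5.HeckeLE g L K) (y : C.bettiH1 τ' K) :
    T.bettiHecke τ' g (C.toBettiTower τ' K y) = C.toBettiTower τ' L (bettiPullAlong τ' (T.albTr g L K h) y) := by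
  show T.bettiHecke τ' g (Module.DirectLimit.of ℂ (Idx C) (C.bettiSysObj τ') (C.bettiSys τ') (OrderDual.toDual K) y) = _
  rw [bettiHecke_of, T.toBettiTower_bettiPullAlong_albTr]

/-- **The level `K` fixes the image of `[·]_K`**: `k · [y]_K = [y]_K` for `k ∈ K` (`Alb(T_k) = 𝟙`).
[cite: Liu2021, Thm. 4.18 (1) (FJcycle.tex l. 2239)] [cite: Milne2005ShimuraVarieties, §5 p. 57 L7–12] -/
theorem bettiHecke_toBettiTower_of_mem {K : C5.SmallLevel C.S.K₀} {k : C.G} (hk : k ∈ K.1.1) (y : C.bettiH1 τ' K) :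
    T.bettiHecke τ' k (C.toBettiTower τ' K y) = C.toBettiTower τ' K y := by
  rw [T.bettiHecke_toBettiTower τ' k (C5.HeckeLE.of_mem hk) y, T.albTr_self hk, bettiPullAlong_id_apply]

/-- `1` acts as the identity (`Alb(T_1) = Alb_u` and `[·]_L ∘ Alb_u^* = [·]_K`). [cite: Liu2021, §4.2 (FJcycle.tex l. 2074)]
[cite: Milne2005ShimuraVarieties, §5 p. 58 L3–6] -/
theorem bettiHecke_one : T.bettiHecke τ' 1 = LinearMap.id := by
  refine Module.DirectLimit.hom_ext fun i => LinearMap.ext fun y => ?_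
  rw [LinearMap.comp_apply, LinearMap.comp_apply, LinearMap.id_apply]
  show T.bettiHecke τ' 1 (C.toBettiTower τ' (OrderDual.ofDual i) y) = C.toBettiTower τ' (OrderDual.ofDual i) y
  rw [T.bettiHecke_toBettiTower τ' 1 (C5.HeckeLE.one_of_le le_rfl) y, T.albTr_one (homOfLE (le_refl (OrderDual.ofDual i)))]
  have hid : (homOfLE (le_refl (OrderDual.ofDual i)) : OrderDual.ofDual i ⟶ OrderDual.ofDual i) = 𝟙 _ := rfl
  rw [hid, C.Atr_id, bettiPullAlong_id_apply]

/-- `gg'` acts as `g` after `g'` (a LEFT action: `Alb(T_g)^* (Alb(T_{g'})^* y) = Alb(T_g ≫ T_{g'})^* y = Alb(T_{gg'})^* y`).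
[cite: Liu2021, §4.2 (FJcycle.tex l. 2074)] [cite: Milne2005ShimuraVarieties, §5 p. 58 L6–11] -/
theorem bettiHecke_mul (g g' : C.G) : T.bettiHecke τ' (g * g') = T.bettiHecke τ' g ∘ₗ T.bettiHecke τ' g' := by
  refine Module.DirectLimit.hom_ext fun i => LinearMap.ext fun y => ?_
  rw [LinearMap.comp_apply, LinearMap.comp_apply, LinearMap.comp_apply]
  show T.bettiHecke τ' (g * g') (C.toBettiTower τ' (OrderDual.ofDual i) y) =
    T.bettiHecke τ' g (T.bettiHecke τ' g' (C.toBettiTower τ' (OrderDual.ofDual i) y))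
  rw [T.bettiHecke_toBettiTower τ' g' (C5.heckeLE_heckeLevel g' (OrderDual.ofDual i)) y,
    T.bettiHecke_toBettiTower τ' g (C5.heckeLE_heckeLevel g (C5.heckeLevel g' (OrderDual.ofDual i))),
    ← bettiPullAlong_comp_apply, T.albTr_mul]
  exact T.bettiHecke_toBettiTower τ' (g * g') _ y

/-- **«an admissible representation of `𝔾(𝔸_F^∞)`» (l. 2081): the Hecke action on `H¹_{B,τ'}(A_∞, ℂ)` as a REPRESENTATION** of `C.G`,
CONSTRUCTED from the Hecke translates (the `rhoB` that `BettiPinning` is stated for). [cite: Liu2021, §4.2 (FJcycle.tex l. 2074, 2079–2081)] -/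
def bettiHeckeRep : Representation ℂ C.G (C.bettiH1Tower τ') where
  toFun := T.bettiHecke τ'
  map_one' := T.bettiHecke_one τ'
  map_mul' g g' := T.bettiHecke_mul τ' g g'

/-- `bettiHeckeRep g = bettiHecke g` (by `rfl`). [cite: Liu2021, §4.2 (FJcycle.tex l. 2081)] -/
theorem bettiHeckeRep_apply (g : C.G) : T.bettiHeckeRep τ' g = T.bettiHecke τ' g := rfl

/-- **Defining formula of the representation**: `g · [y]_K = [Alb(T_g)^* y]_L` for any admissible `L` (`g⁻¹Lg ⊆ K`).
[cite: Liu2021, §4.2 (FJcycle.tex l. 2074, 2079–2081)] -/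
theorem bettiHeckeRep_toBettiTower (g : C.G) {L K : C5.SmallLevel C.S.K₀} (h : C5.HeckeLE g L K) (y : C.bettiH1 τ' K) :
    T.bettiHeckeRep τ' g (C.toBettiTower τ' K y) = C.toBettiTower τ' L (bettiPullAlong τ' (T.albTr g L K h) y) :=
  T.bettiHecke_toBettiTower τ' g h y

/-- `[·]_K` lands in the `K`-invariants: `k · [y]_K = [y]_K` for `k ∈ K`. [cite: Liu2021, Thm. 4.18 (1) (FJcycle.tex l. 2239)] -/
theorem bettiHeckeRep_toBettiTower_of_mem {K : C5.SmallLevel C.S.K₀} {k : C.G} (hk : k ∈ K.1.1) (y : C.bettiH1 τ' K) :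
    T.bettiHeckeRep τ' k (C.toBettiTower τ' K y) = C.toBettiTower τ' K y :=
  T.bettiHecke_toBettiTower_of_mem τ' hk y

/-- **Smoothness**: every class of `H¹_{B,τ'}(A_∞, ℂ)` is fixed by some sufficiently small level. [cite: Liu2021, §4.2 (FJcycle.tex l. 2081)] -/
theorem exists_forall_bettiHeckeRep_eq (x : C.bettiH1Tower τ') :
    ∃ K : C5.SmallLevel C.S.K₀, ∀ k ∈ K.1.1, T.bettiHeckeRep τ' k x = x := by
  obtain ⟨K, y, rfl⟩ := C.exists_eq_toBettiTower τ' x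
  exact ⟨K, fun k hk => T.bettiHeckeRep_toBettiTower_of_mem τ' hk y⟩

/-! ## §3 The Betti pinning of the constructed tower -/

/-- **The Betti pinning of `(H¹_{B,τ'}(A_∞, ℂ), bettiHeckeRep)` to the levels** — the hypothesis structure `Sec42Data.BettiPinning` INHABITED for
every §4.2 datum and family of translates, granted injective Betti pull-backs along the transitions (`hIB`; see
`injective_bettiPullAlong_of_injective_dualMap` for its discharge from the étale injectivity): `b K := [·]_K`, `b_hecke` = the defining
formula, `exhaust` = every class is a level class. [cite: Liu2021, §4.2 (FJcycle.tex l. 2074, 2079–2081) and Thm. 4.18 (1) l. 2239] -/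
def bettiPinningOfTranslates
    (hIB : ∀ ⦃K K' : C5.SmallLevel C.S.K₀⦄ (f : K' ⟶ K), Function.Injective (bettiPullAlong τ' (C.Atr f))) :
    C.BettiPinning T τ' (C.bettiH1Tower τ') (T.bettiHeckeRep τ') where
  b K := C.toBettiTower τ' K
  b_injective K := C.toBettiTower_injective τ' hIB K
  b_hecke g _ _ h y := T.bettiHeckeRep_toBettiTower τ' g h y
  exhaust x := C.exists_eq_toBettiTower τ' x

/-- The level maps of the constructed pinning are the canonical maps `[·]_K` (by `rfl`). [cite: Liu2021, §4.2 (FJcycle.tex l. 2079)] -/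
theorem bettiPinningOfTranslates_b
    (hIB : ∀ ⦃K K' : C5.SmallLevel C.S.K₀⦄ (f : K' ⟶ K), Function.Injective (bettiPullAlong τ' (C.Atr f)))
    (K : C5.SmallLevel C.S.K₀) : (T.bettiPinningOfTranslates τ' hIB).b K = C.toBettiTower τ' K :=
  rfl

/-- **The pinning from the ÉTALE injectivity** `hI` (e.g. the tree's `hI_GSM` for the record curve), through the tree's comparison family
`h1ComparisonFamilyAlong τ' ℓ ι` — the form in which the consumers (S1∕S1b, which carry `ℓ` and `ι' : ℂ ≃+* ℚ̄_ℓ` in their binders) call it.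
[cite: Liu2021, §4.2 (FJcycle.tex l. 2079–2081) and §4.2 l. 2154] [cite: SGA4Tome3, Exp. XI Thm. 4.4] -/
def bettiPinningOfTranslatesOfEtale {ℓ : ℕ} [Fact ℓ.Prime] (ι : ℂ ≃+* AlgebraicClosure ℚ_[ℓ])
    (hI : ∀ ⦃K K' : C5.SmallLevel C.S.K₀⦄ (f : K' ⟶ K), Function.Injective (rationalTateModuleMap ℓ (C.Atr f)).dualMap) :
    C.BettiPinning T τ' (C.bettiH1Tower τ') (T.bettiHeckeRep τ') :=
  T.bettiPinningOfTranslates τ' fun _ _ f =>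
    injective_bettiPullAlong_of_injective_dualMap τ' (h1ComparisonFamilyAlong τ' ℓ ι) (C.Atr f) (hI f)

/-- **Nonemptiness form** (the shape of the registered `StubPinBettiPinning`-type statements): for every §4.2 datum with translates and
injective étale pull-backs there EXIST a Betti tower module and a pinning. [cite: Liu2021, §4.2 (FJcycle.tex l. 2077–2081)] -/
theorem nonempty_bettiPinning_of_injective {ℓ : ℕ} [Fact ℓ.Prime] (ι : ℂ ≃+* AlgebraicClosure ℚ_[ℓ])
    (hI : ∀ ⦃K K' : C5.SmallLevel C.S.K₀⦄ (f : K' ⟶ K), Function.Injective (rationalTateModuleMap ℓ (C.Atr f)).dualMap) :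
    Nonempty (C.BettiPinning T τ' (C.bettiH1Tower τ') (T.bettiHeckeRep τ')) :=
  ⟨T.bettiPinningOfTranslatesOfEtale τ' ι hI⟩

end Sec42Data.HeckeTranslates

end Literature.NumberTheory.Automorphic.Liu2021.AppendixC

end
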